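import Mathlib.GroupTheory.Perm.Fin
import Literature.Combinatorics.SimpleGraph.MatchingMinorBicontraction
import Literature.Combinatorics.SimpleGraph.MatchingMinorLift
import Literature.Combinatorics.SimpleGraph.PfaffianBipartite
import HarnessLib

/-!
# Normal position for vertices of degree one and two (Little's theorem, hard direction: tools IV)

Topic `Combinatorics/SimpleGraph`; theorems only. The descending induction proving the hard
direction of Little's theorem (`Little1975_isPfaffianBipartite_iff_not_isMatchingMinor`,
`LittleTheorem.lean`) removes vertices of small degree from a non-Pfaffian bipartite graph
`G ⊆ Fin n × Fin n` (edge-set encoding of `MatchingMinor.lean`):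

* degree two: after relabelling rows and columns (`relabel`, an isomorphism) the vertex is the row
  `0` with neighbours the columns `0, 1` (`RowZeroBicontractible`) and is bicontracted
  (`exists_relabel_rowZeroBicontractible`; columns first go through `transposeEdges`,
  `card_filter_snd_eq_card_filter_fst_transposeEdges`);
* degree one, at a row `i₀` whose neighbour column `j₀` also has degree one (its other edges lie
  on no perfect matching and are deleted first): after relabelling, `(0, 0)` is the only edge at
  row `0` and at column `0`, and the SHIFT `bicontractRowZero G₀` (here: delete row `0` and column
  `0`, shift indices) is a central subgraph of `G₀` (`isCentralSubgraph_bicontractRowZero_of_shift`)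
  which is Pfaffian only if `G₀` is (`IsPfaffianBipartite.of_shift`), and whose matching minors are
  matching minors of `G₀` (`IsMatchingMinor.of_shift`).

Also: relabelling permutes row and column degrees (`card_filter_fst_relabel`,
`card_filter_snd_relabel`).

## References

* N. Robertson, P. D. Seymour, R. Thomas, *Permanents, Pfaffian orientations, and even directed
  circuits*, Ann. of Math. 150 (1999) 929–975, §4 (bicontraction). [RobertsonSeymourThomas1999]
* C. H. C. Little, *A characterization of convertible (0,1)-matrices*, J. Combin. Theory Ser. B
  18 (1975) 187–208, §4. [Little1975]
-/

namespace Literature.Combinatorics.SimpleGraph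

open Equiv Finset

/-! ### Degrees under relabelling and transposition -/

section Degrees

variable {n : ℕ}

/-- The edges at the row `ρ i` of the relabelled graph are the relabelled edges at row `i`.
[folklore] -/
theorem filter_fst_relabel (G : Finset (Fin n × Fin n)) (ρ κ : Perm (Fin n)) (i : Fin n) :
    (relabel G ρ κ).filter (fun e => e.1 = ρ i) =
      (G.filter fun e => e.1 = i).map (ρ.prodCongr κ).toEmbedding := by
  ext ⟨a, b⟩
  simp only [Finset.mem_filter, mem_relabel_iff, Finset.mem_map_equiv, Equiv.prodCongr_symm,
    Equiv.prodCongr_apply, Prod.map_apply]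
  constructor
  · rintro ⟨h, rfl⟩; exact ⟨h, by simp⟩
  · rintro ⟨h, h'⟩; exact ⟨h, by rw [← h']; simp⟩

/-- The edges at the column `κ j` of the relabelled graph are the relabelled edges at column `j`.
[folklore] -/
theorem filter_snd_relabel (G : Finset (Fin n × Fin n)) (ρ κ : Perm (Fin n)) (j : Fin n) :
    (relabel G ρ κ).filter (fun e => e.2 = κ j) =
      (G.filter fun e => e.2 = j).map (ρ.prodCongr κ).toEmbedding := by
  ext ⟨a, b⟩
  simp only [Finset.mem_filter, mem_relabel_iff, Finset.mem_map_equiv, Equiv.prodCongr_symm,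
    Equiv.prodCongr_apply, Prod.map_apply]
  constructor
  · rintro ⟨h, rfl⟩; exact ⟨h, by simp⟩
  · rintro ⟨h, h'⟩; exact ⟨h, by rw [← h']; simp⟩

/-- Relabelling permutes the row degrees. [folklore] -/
theorem card_filter_fst_relabel (G : Finset (Fin n × Fin n)) (ρ κ : Perm (Fin n)) (i : Fin n) :
    ((relabel G ρ κ).filter fun e => e.1 = ρ i).card = (G.filter fun e => e.1 = i).card := by
  rw [filter_fst_relabel, Finset.card_map]

/-- Relabelling permutes the column degrees. [folklore] -/
theorem card_filter_snd_relabel (G : Finset (Fin n × Fin n)) (ρ κ : Perm (Fin n)) (j : Fin n) :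
    ((relabel G ρ κ).filter fun e => e.2 = κ j).card = (G.filter fun e => e.2 = j).card := by
  rw [filter_snd_relabel, Finset.card_map]

/-- The edges at column `j` are, transposed, the edges at row `j` of the transpose. [folklore] -/
theorem filter_snd_eq_map_filter_fst_transposeEdges (G : Finset (Fin n × Fin n)) (j : Fin n) :
    (G.filter fun e => e.2 = j) =
      ((transposeEdges G).filter fun e => e.1 = j).map (Equiv.prodComm _ _).toEmbedding := by
  ext ⟨a, b⟩
  simp only [Finset.mem_filter, Finset.mem_map_equiv, Equiv.prodComm_symm, Equiv.prodComm_apply,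
    Prod.swap_prod_mk, mem_transposeEdges_iff]

/-- Column degrees are row degrees of the transpose. [folklore] -/
theorem card_filter_snd_eq_card_filter_fst_transposeEdges (G : Finset (Fin n × Fin n)) (j : Fin n) :
    (G.filter fun e => e.2 = j).card = ((transposeEdges G).filter fun e => e.1 = j).card := by
  rw [filter_snd_eq_map_filter_fst_transposeEdges, Finset.card_map]

/-- The edges at a row `i` are pairs `(i, j)`. [folklore] -/
theorem eq_mk_of_mem_filter_fst {G : Finset (Fin n × Fin n)} {i : Fin n} {e : Fin n × Fin n}
    (h : e ∈ G.filter fun e => e.1 = i) : e = (i, e.2) := by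
  rw [Finset.mem_filter] at h
  exact Prod.ext h.2 rfl

end Degrees

/-! ### Degree two: normal position -/

section DegreeTwo

variable {m : ℕ}

/-- **A row of degree two can be moved into normal position**: if row `i₀` of
`G ⊆ K_{m+2,m+2}` has exactly two edges then, after permuting rows and columns, row `0` has
degree two with neighbours the columns `0` and `1` (`RowZeroBicontractible`), ready to be
bicontracted by `bicontractRowZero`. [folklore] -/
theorem exists_relabel_rowZeroBicontractible {G : Finset (Fin (m + 2) × Fin (m + 2))}
    {i₀ : Fin (m + 2)} (h2 : (G.filter fun e => e.1 = i₀).card = 2) :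
    ∃ ρ κ : Perm (Fin (m + 2)), RowZeroBicontractible (relabel G ρ κ) := by
  obtain ⟨e₁, e₂, hne, heq⟩ := Finset.card_eq_two.1 h2
  have he₁ : e₁ = (i₀, e₁.2) :=
    eq_mk_of_mem_filter_fst (G := G) (by rw [heq]; exact Finset.mem_insert_self _ _)
  have he₂ : e₂ = (i₀, e₂.2) :=
    eq_mk_of_mem_filter_fst (G := G) (by rw [heq]; simp)
  set j₁ := e₁.2 with hj₁
  set j₂ := e₂.2 with hj₂
  have hj : j₁ ≠ j₂ := fun h => hne (by rw [he₁, he₂, h])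
  -- rows: `i₀ ↦ 0`; columns: `j₁ ↦ 0`, `j₂ ↦ 1`
  set ρ : Perm (Fin (m + 2)) := swap i₀ 0 with hρ
  set κ₁ : Perm (Fin (m + 2)) := swap j₁ 0 with hκ₁
  have hj₂' : κ₁ j₂ ≠ 0 := by
    intro h
    have : κ₁ j₂ = κ₁ j₁ := by rw [h, hκ₁, swap_apply_left]
    exact hj (κ₁.injective this).symm
  set κ : Perm (Fin (m + 2)) := κ₁.trans (swap (κ₁ j₂) 1) with hκ
  have hρi : ρ i₀ = 0 := swap_apply_left _ _
  have hκ1 : κ j₁ = 0 := by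
    rw [hκ, Equiv.trans_apply, hκ₁, swap_apply_left, ← hκ₁,
      swap_apply_of_ne_of_ne (Ne.symm hj₂') Fin.zero_ne_one]
  have hκ2 : κ j₂ = 1 := by
    rw [hκ, Equiv.trans_apply, swap_apply_left]
  refine ⟨ρ, κ, ?_⟩
  unfold RowZeroBicontractible
  rw [← hρi, filter_fst_relabel, heq, he₁, he₂, Finset.map_insert, Finset.map_singleton]
  simp [hρi, hκ1, hκ2]

/-- The same for a column of degree two, through the transpose. [folklore] -/
theorem exists_relabel_transposeEdges_rowZeroBicontractible
    {G : Finset (Fin (m + 2) × Fin (m + 2))} {j₀ : Fin (m + 2)}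
    (h2 : (G.filter fun e => e.2 = j₀).card = 2) :
    ∃ ρ κ : Perm (Fin (m + 2)), RowZeroBicontractible (relabel (transposeEdges G) ρ κ) := by
  rw [card_filter_snd_eq_card_filter_fst_transposeEdges] at h2
  exact exists_relabel_rowZeroBicontractible h2

end DegreeTwo

/-! ### Degree one: the shift -/

section Shift

variable {m : ℕ}

/-- If column `0` of `G₀` carries only the edge `(0, 0)`, the bicontraction formula
`bicontractRowZero G₀` is the plain shift: `(a, b)` is an edge iff `(a+1, b+1) ∈ G₀`. [folklore] -/
theorem mem_bicontractRowZero_iff_of_shift {G₀ : Finset (Fin (m + 2) × Fin (m + 2))}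
    (hcol0 : ∀ i, (i, (0 : Fin (m + 2))) ∈ G₀ → i = 0) (a b : Fin (m + 1)) :
    (a, b) ∈ bicontractRowZero G₀ ↔ (a.succ, b.succ) ∈ G₀ := by
  rw [mem_bicontractRowZero_iff]
  constructor
  · rintro (h | ⟨-, h⟩)
    · exact h
    · exact absurd (hcol0 _ h) (Fin.succ_ne_zero _)
  · exact Or.inl

/-- **The shift is a central subgraph**: if `(0, 0) ∈ G₀` and column `0` carries no other edge,
then `bicontractRowZero G₀` (rows and columns `≥ 1` of `G₀`, shifted) is central in `G₀`, the
complement `{row 0, column 0}` being matched by `(0, 0)`. [folklore] -/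
theorem isCentralSubgraph_bicontractRowZero_of_shift {G₀ : Finset (Fin (m + 2) × Fin (m + 2))}
    (hcol0 : ∀ i, (i, (0 : Fin (m + 2))) ∈ G₀ → i = 0) (h00 : ((0 : Fin (m + 2)), (0 : Fin (m + 2))) ∈ G₀) :
    IsCentralSubgraph (bicontractRowZero G₀) G₀ := by
  refine isCentralSubgraph_of_injective (Fin.succEmb (m + 1)) (Fin.succEmb (m + 1))
    (fun e he => (mem_bicontractRowZero_iff_of_shift hcol0 e.1 e.2).1 he) (fun _ => 0)
    (fun i hi => ?_) (fun i _ => fun ⟨y, hy⟩ => Fin.succ_ne_zero _ hy) (fun i i' hi hi' _ => ?_)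
  · obtain rfl : i = 0 := by
      induction i using Fin.cases with
      | zero => rfl
      | succ a => exact absurd ⟨a, rfl⟩ hi
    exact h00
  · have h0 : ∀ i : Fin (m + 2), i ∉ Set.range (Fin.succEmb (m + 1)) → i = 0 := by
      intro i hi
      induction i using Fin.cases with
      | zero => rfl
      | succ a => exact absurd ⟨a, rfl⟩ hi
    rw [h0 i hi, h0 i' hi']

/-- **The shift reflects Pfaffian-ness**: if `(0, 0)` is the only edge of `G₀` at row `0` and at
column `0`, and the shift `bicontractRowZero G₀` is Pfaffian, then so is `G₀` (every perfect
matching of `G₀` fixes `0` and restricts to a perfect matching of the shift, with the same sign).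
[folklore] -/
theorem IsPfaffianBipartite.of_shift {G₀ : Finset (Fin (m + 2) × Fin (m + 2))}
    (hrow0 : ∀ j, ((0 : Fin (m + 2)), j) ∈ G₀ → j = 0)
    (hcol0 : ∀ i, (i, (0 : Fin (m + 2))) ∈ G₀ → i = 0)
    (h : IsPfaffianBipartite (bicontractRowZero G₀)) : IsPfaffianBipartite G₀ := by
  obtain ⟨s', hs'⟩ := h
  refine ⟨fun e => if e.1 = 0 then 1 else s' (shiftDown e.1, shiftDown e.2), fun σ hσ => ?_⟩
  set p := (Perm.decomposeFin σ).1 with hp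
  set σ' := (Perm.decomposeFin σ).2 with hσ'
  have hdec : σ = Perm.decomposeFin.symm (p, σ') := by
    rw [hp, hσ', Prod.mk.eta, Equiv.symm_apply_apply]
  have h0 : σ 0 = p := by
    conv_lhs => rw [hdec]
    exact Perm.decomposeFin_symm_apply_zero p σ'
  have hp0 : p = 0 := by rw [← h0]; exact hrow0 _ (hσ 0)
  have hsucc : ∀ a, σ a.succ = (σ' a).succ := fun a => by
    conv_lhs => rw [hdec]
    rw [Perm.decomposeFin_symm_apply_succ σ' p a, hp0, swap_self, Equiv.refl_apply]
  have hsign : Perm.sign σ = Perm.sign σ' := by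
    conv_lhs => rw [hdec]
    rw [Perm.decomposeFin.symm_sign p σ', hp0, if_pos rfl, one_mul]
  have hmem : ∀ a, (a, σ' a) ∈ bicontractRowZero G₀ := fun a => by
    rw [mem_bicontractRowZero_iff_of_shift hcol0, ← hsucc]
    exact hσ a.succ
  have hpol := hs' σ' hmem
  rw [hsign, Fin.prod_univ_succ]
  simp only [Fin.succ_ne_zero, if_false, if_true, one_mul, shiftDown_succ]
  simp_rw [hsucc, shiftDown_succ]
  exact hpol

/-- **Matching minors of the shift are matching minors of `G₀`** (`(0, 0)` the only edge at
column `0`): a central subgraph of the shift is central in `G₀`, its complement enlarged by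
`{row 0, column 0}` matched along `(0, 0)`. [folklore] -/
theorem IsMatchingMinor.of_shift {l : ℕ} {H : Finset (Fin l × Fin l)}
    {G₀ : Finset (Fin (m + 2) × Fin (m + 2))}
    (hcol0 : ∀ i, (i, (0 : Fin (m + 2))) ∈ G₀ → i = 0) (h00 : ((0 : Fin (m + 2)), (0 : Fin (m + 2))) ∈ G₀)
    (h : IsMatchingMinor H (bicontractRowZero G₀)) : IsMatchingMinor H G₀ :=
  (isCentralSubgraph_bicontractRowZero_of_shift hcol0 h00).isMatchingMinor_trans h

/-- After the relabelling `swap i₀ 0` of rows and `swap j₀ 0` of columns, the edge `(i₀, j₀)`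
becomes `(0, 0)`, and if it was the only edge at row `i₀` and at column `j₀` then `(0, 0)` is the
only edge at row `0` and at column `0`. [folklore] -/
theorem relabel_swap_degree_one {n : ℕ} {G : Finset (Fin (n + 1) × Fin (n + 1))} {i₀ j₀ : Fin (n + 1)}
    (hrow : ∀ j, (i₀, j) ∈ G → j = j₀) (hcol : ∀ i, (i, j₀) ∈ G → i = i₀) (he : (i₀, j₀) ∈ G) :
    (∀ j, ((0 : Fin (n + 1)), j) ∈ relabel G (swap i₀ 0) (swap j₀ 0) → j = 0) ∧
    (∀ i, (i, (0 : Fin (n + 1))) ∈ relabel G (swap i₀ 0) (swap j₀ 0) → i = 0) ∧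
    ((0 : Fin (n + 1)), (0 : Fin (n + 1))) ∈ relabel G (swap i₀ 0) (swap j₀ 0) := by
  refine ⟨fun j hj => ?_, fun i hi => ?_, ?_⟩
  · rw [mem_relabel_iff] at hj
    simp only [Equiv.symm_swap, swap_apply_right] at hj
    have h1 := hrow _ hj
    have h2 := congrArg (swap j₀ 0) h1
    rwa [swap_apply_self, swap_apply_left] at h2
  · rw [mem_relabel_iff] at hi
    simp only [Equiv.symm_swap, swap_apply_right] at hi
    have h1 := hcol _ hi
    have h2 := congrArg (swap i₀ 0) h1
    rwa [swap_apply_self, swap_apply_left] at h2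
  · rw [mem_relabel_iff]
    simpa using he

end Shift

end Literature.Combinatorics.SimpleGraph
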